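import Summits.QuantumFields.YangMills.Theorems.UnitScaleTiltProp7CovLineGradL2
import Summits.QuantumFields.YangMills.Theorems.UnitScaleTiltProp7TrueLinPureGaugeIter
import HarnessLib

/-!
# Route `UnitScaleTilt`, crux K1 «MinimiserStabilityRegPr» (stmt-QuantumFields-19200), route-R [RP] at a curved background — THE CURVED N6,
# ROW (R-B), PART 6e: THE PURE `LINE`-TOWER — mass and covariant gradient energy of `S_{j+1} = LINE_{Ū₀^{(j)}}(S_j)`, `S_0 = Y`, along the background tower:
# `‖S_j‖ ≤ ρ_m^j‖Y‖`, `‖∇^{(j)}S_j‖ ≤ ρ_g^j‖∇^{U₀}Y‖ + (Σ_{i<j} ρ_g^{j−1−i}κ_iρ_m^i)·‖Y‖` (`ρ_g = √(L⁴L^{−d})`, `ρ_m = √(L²L^{−d})`, `κ_i = O(L^{5/2}a_i)`)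

Cell `ym3-torus`, D-0154 (3c) R3 twin-width seat `ym-routeR-w2` (W-SEAT MAP pass #3 row M9; architecture «ℓ²-Minkowski over levels, level-local», ★★OWNER g26
ACK 12).  THEOREMS ONLY (0 `def`, 0 `sorry`); `--supports stmt-QuantumFields-19200`, count-neutral.  YM₃ on T³ is a ladder rung (R3), not the Clay problem; nothing here
claims the curved N6 bound, S2, P, the crux or the gap.

THE STEP.  The one-step transfer of `Prop7CovLineGradL2` (`‖∇^{Ū}LINE_VZ‖ ≤ ρ_g‖∇^VZ‖ + κ‖Z‖`) and the one-step mass contraction `Prop7TrueLinLineBound.sum_normSq_line_le`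
(`‖LINE_VZ‖ ≤ ρ_m‖Z‖`, ★w2-20520 g3) iterated along the tower `Ū₀^{(j)}` of a background with `PlaqSmall (ε(L^k)⁻²) U₀` in the [B7] Prop. 2 regime: the level-`j`
plaquettes are `< a_j := 2ε(L^j/L^k)²` (`Prop7CovIterLambdaBound.tower_plaq_lt`), the (0.4) loop variables `≤ θ_j := ((d+2)L)²/4·a_j` (`dist1_loopHol_le`), and
`θ_j < δ_N`, `θ_j ≤ 1/6` follow from `2ε ≤ 2δ_N/((d+4)L)²`.  With `G_j − S_j` controlled by ✓ p608741 `Prop7TrueLinIterDefect` this discharges the displayed (hgrad)∕(hmass)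
rows of `Prop7CovIterLambdaEnergy` (next file).
* §1 `theta_lt_deltaSU`, `theta_le_sixth` (the numerical conditions per level); `grad_recursion` (real sequences).
* §2 ★★ `lineIter_mass_grad_le` — the displayed tower bounds for every `j ≤ k`.
HONEST SCOPE.  Iteration bookkeeping over the tree's one-step estimates; general `d`.

References: T. Bałaban, CMP 95 (1984) 17–40 [Balaban1984PropagatorsI] ((1.18)–(1.20) pp.19–20); CMP 98 (1985) 17–51 [Balaban1985Averaging] (Prop. 2 (53) p.26).
-/

noncomputable section

open scoped BigOperators Matrix.Norms.L2Operator

namespace Summit.QuantumFields.YangMills.Theorems.Prop7CovLineIterGrad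

open Literature.MathematicalPhysics.QuantumFieldTheory.Balaban1983to89
open Finset T4Continuum BlockAveraging AveragingRT ExpMeanLog BlockAveragingEMLLinearised BlockAveragingEMLLinearisedBackground BlockAveragingEMLProp2
open LatticeWordStokes (dist1_loopHol_le)
open Summit.QuantumFields.YangMills.Theorems.Prop7CovIterLambdaBound (tower_plaq_lt)
open Summit.QuantumFields.YangMills.Theorems.Prop7TrueLinLineBound (sum_normSq_line_le)
open Summit.QuantumFields.YangMills.Theorems.Prop7CovLineGradL2 (sqrt_sum_normSq_covGrad_line_le)
open Summit.QuantumFields.YangMills.Theorems.Prop7TrueLinPureGaugeIter (iter_succ_apply)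

variable {P : Params} {n : Type*} [Fintype n] [DecidableEq n] [Nonempty n]

/-! ## §1 The numerical conditions per level; the real-sequence recursion -/

omit [DecidableEq n] [Nonempty n] in
/-- `((d+2)L)²/4 · (2ε) < δ_N` when `2ε ≤ 2δ_N/((d+4)L)²`. [folklore] -/
theorem theta_lt_deltaSU [Nonempty n] {ε : ℝ} (hε : 0 < ε) (hε2 : 2 * ε ≤ 2 * deltaSU n / (((P.d + 4) * P.L : ℕ) : ℝ) ^ 2) :
    (((P.d + 2) * P.L : ℕ) : ℝ) ^ 2 / 4 * (2 * ε) < deltaSU n := by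
  have hD : (0 : ℝ) < (((P.d + 4) * P.L : ℕ) : ℝ) ^ 2 := by have := P.L_pos; positivity
  have h2 : 2 * deltaSU n / (((P.d + 4) * P.L : ℕ) : ℝ) ^ 2 = 2 * (deltaSU n / (((P.d + 4) * P.L : ℕ) : ℝ) ^ 2) := by ring
  rw [h2] at hε2
  have hδ : (((P.d + 4) * P.L : ℕ) : ℝ) ^ 2 * ε ≤ deltaSU n := by
    have := (le_div_iff₀ hD).mp (by linarith : ε ≤ deltaSU n / (((P.d + 4) * P.L : ℕ) : ℝ) ^ 2)
    linarith
  have h1 : (((P.d + 2) * P.L : ℕ) : ℝ) ^ 2 < (((P.d + 4) * P.L : ℕ) : ℝ) ^ 2 := by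
    have hL : (0 : ℝ) < P.L := by exact_mod_cast P.L_pos
    have : (((P.d + 2) * P.L : ℕ) : ℝ) < (((P.d + 4) * P.L : ℕ) : ℝ) := by push_cast; nlinarith
    exact pow_lt_pow_left₀ this (by positivity) two_ne_zero
  nlinarith

omit [DecidableEq n] [Nonempty n] in
/-- `((d+2)L)²/4 · (2ε) ≤ 1/6` under the same condition (`δ_N ≤ 1/3`). [folklore] -/
theorem theta_le_sixth [Nonempty n] {ε : ℝ} (hε : 0 < ε) (hε2 : 2 * ε ≤ 2 * deltaSU n / (((P.d + 4) * P.L : ℕ) : ℝ) ^ 2) :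
    (((P.d + 2) * P.L : ℕ) : ℝ) ^ 2 / 4 * (2 * ε) ≤ 1 / 6 := by
  have h := theta_lt_deltaSU (P := P) (n := n) hε hε2
  have hδ3 : deltaSU n ≤ 1 / 3 := min_le_left _ _
  -- `((d+2)L)²/4·2ε < δ_N ≤ 1/3`, and the finer estimate `≤ δ_N·(d+2)²/(2(d+4)²) ≤ δ_N/2`:
  have hD : (0 : ℝ) < (((P.d + 4) * P.L : ℕ) : ℝ) ^ 2 := by have := P.L_pos; positivity
  have h2 : 2 * deltaSU n / (((P.d + 4) * P.L : ℕ) : ℝ) ^ 2 = 2 * (deltaSU n / (((P.d + 4) * P.L : ℕ) : ℝ) ^ 2) := by ring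
  rw [h2] at hε2
  have hδ : (((P.d + 4) * P.L : ℕ) : ℝ) ^ 2 * ε ≤ deltaSU n := by
    have := (le_div_iff₀ hD).mp (by linarith : ε ≤ deltaSU n / (((P.d + 4) * P.L : ℕ) : ℝ) ^ 2)
    linarith
  have h1 : (((P.d + 2) * P.L : ℕ) : ℝ) ^ 2 ≤ (((P.d + 4) * P.L : ℕ) : ℝ) ^ 2 := by
    have : (((P.d + 2) * P.L : ℕ) : ℝ) ≤ (((P.d + 4) * P.L : ℕ) : ℝ) := by
      have hL : (0 : ℝ) ≤ P.L := Nat.cast_nonneg _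
      push_cast; nlinarith
    exact pow_le_pow_left₀ (Nat.cast_nonneg _) this 2
  nlinarith [hε.le]

omit [Fintype n] [DecidableEq n] [Nonempty n] in
/-- **THE REAL-SEQUENCE RECURSION**: `g_{j+1} ≤ ρ_g g_j + κ_j m_j`, `m_j ≤ ρ_m^j M` ⇒ `g_j ≤ ρ_g^j g_0 + (Σ_{i<j} ρ_g^{j−1−i} κ_i ρ_m^i)·M`. [folklore] -/
theorem grad_recursion {ρg ρm M : ℝ} (hρg : 0 ≤ ρg) (g m κ : ℕ → ℝ) (hκ : ∀ j, 0 ≤ κ j) (k : ℕ)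
    (hm : ∀ j, j ≤ k → m j ≤ ρm ^ j * M) (hg : ∀ j, j < k → g (j + 1) ≤ ρg * g j + κ j * m j) :
    ∀ j, j ≤ k → g j ≤ ρg ^ j * g 0 + (∑ i ∈ range j, ρg ^ (j - 1 - i) * κ i * ρm ^ i) * M := by
  intro j
  induction j with
  | zero => intro _; simp
  | succ j ih =>
    intro hj
    have hj' : j < k := Nat.lt_of_succ_le hj
    have h1 := hg j hj'
    have h2 := ih hj'.le
    have h3 := hm j hj'.le
    have hsum : ∑ i ∈ range (j + 1), ρg ^ (j + 1 - 1 - i) * κ i * ρm ^ i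
        = ρg * ∑ i ∈ range j, ρg ^ (j - 1 - i) * κ i * ρm ^ i + κ j * ρm ^ j := by
      rw [Finset.sum_range_succ, Finset.mul_sum]
      congr 1
      · refine Finset.sum_congr rfl fun i hi => ?_
        have hi' : i < j := Finset.mem_range.mp hi
        have e : j + 1 - 1 - i = (j - 1 - i) + 1 := by omega
        rw [e, pow_succ]; ring
      · simp
    rw [hsum]
    have hκm : κ j * m j ≤ κ j * (ρm ^ j * M) := mul_le_mul_of_nonneg_left h3 (hκ j)
    have hρgg : ρg * g j ≤ ρg * (ρg ^ j * g 0 + (∑ i ∈ range j, ρg ^ (j - 1 - i) * κ i * ρm ^ i) * M) := mul_le_mul_of_nonneg_left h2 hρg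
    calc g (j + 1) ≤ ρg * g j + κ j * m j := h1
      _ ≤ ρg * (ρg ^ j * g 0 + (∑ i ∈ range j, ρg ^ (j - 1 - i) * κ i * ρm ^ i) * M) + κ j * (ρm ^ j * M) := add_le_add hρgg hκm
      _ = _ := by rw [pow_succ]; ring

/-! ## §2 ★★ The pure `LINE`-tower: mass and covariant gradient energy -/

set_option maxHeartbeats 400000 in
/-- ★★ **THE PURE `LINE`-TOWER ALONG THE BACKGROUND TOWER.**  `U₀ ∈ SU(N)` with `PlaqSmall (ε(L^k)⁻²) U₀`, `0 < ε`, `C₀(d)ε ≤ 1/3`, `2ε ≤ 2δ_N/((d+4)L)²`, `k ≤ m + K`;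
`S_0 = Y`, `S_{j+1} = LINE_{Ū₀^{(j)}}(S_j)`.  Then for every `j ≤ k`, with `ρ_m = √(L^{−d}L²)`, `ρ_g = √(L⁴L^{−d})`, `a_i = 2ε(L^i/L^k)²`, `θ_i = ((d+2)L)²/4·a_i`,
`κ_i = 2L²a_i·√(L⁴L^{−d}d) + (2(d+2)²L²a_i + 4θ_i)·√(L²L^{−d}d)`:
`√(Σ‖S_j‖²) ≤ ρ_m^j·√(Σ‖Y‖²)` and `√(Σ_{b,ν}‖(∇^{(j)}_νS_j)(b)‖²) ≤ ρ_g^j·√(Σ_{b,ν}‖(∇^{U₀}_νY)(b)‖²) + (Σ_{i<j} ρ_g^{j−1−i}κ_iρ_m^i)·√(Σ‖Y‖²)`.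
[cite: Balaban1984PropagatorsI, (1.18)-(1.20) pp.19-20; Balaban1985Averaging, Prop. 2 (53) p.26] -/
theorem lineIter_mass_grad_le (U₀ : GaugeField P 0 (Matrix.specialUnitaryGroup n ℂ)) (Y : PBond P 0 → Matrix n n ℂ)
    (S : (k : ℕ) → PBond P k → Matrix n n ℂ) (hS0 : ∀ b, S 0 b = Y b)
    (hSs : ∀ (k : ℕ) (c : PBond P (k + 1)), S (k + 1) c
      = ((Fintype.card (Idx P) : ℂ))⁻¹ • ∑ i : Idx P,
          ((holAt (Averaging.iter (fun i => blockAvg (P := P) (j := i) (expMeanLogSU (n := n))) k U₀) (walk (emb c.src) (stairWord i.2.1 (off i.1))) :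
              Matrix.specialUnitaryGroup n ℂ) : Matrix n n ℂ) *
            covWalkSum (Averaging.iter (fun i => blockAvg (P := P) (j := i) (expMeanLogSU (n := n))) k U₀) (S k)
              (walk (walkEnd (emb c.src) (stairWord i.2.1 (off i.1))) (List.replicate P.L (c.dir, true))) *
          star ((holAt (Averaging.iter (fun i => blockAvg (P := P) (j := i) (expMeanLogSU (n := n))) k U₀) (walk (emb c.src) (stairWord i.2.1 (off i.1))) :
              Matrix.specialUnitaryGroup n ℂ) : Matrix n n ℂ))
    {k : ℕ} (hk : k ≤ P.m + P.K) {ε : ℝ} (hε : 0 < ε)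
    (hε3 : (143 * ((((P.d + 4 : ℕ) : ℝ)) ^ 2 / 4) ^ 2) * ε ≤ 1 / 3)
    (hε2 : 2 * ε ≤ 2 * deltaSU n / (((P.d + 4) * P.L : ℕ) : ℝ) ^ 2)
    (hU : PlaqSmall (ε * (((P.L : ℝ) ^ k)⁻¹) ^ 2) U₀) :
    ∀ j, j ≤ k →
      Real.sqrt (∑ b : PBond P j, ‖S j b‖ ^ 2) ≤ Real.sqrt (((P.L : ℝ) ^ P.d)⁻¹ * (P.L : ℝ) ^ 2) ^ j * Real.sqrt (∑ b : PBond P 0, ‖Y b‖ ^ 2)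
      ∧ Real.sqrt (∑ b : PBond P j, ∑ ν : Fin P.d,
            ‖((Averaging.iter (fun i => blockAvg (P := P) (j := i) (expMeanLogSU (n := n))) j U₀ ⟨b.src, ν⟩ : Matrix.specialUnitaryGroup n ℂ) : Matrix n n ℂ)
                * S j ⟨b.src.shift ν, b.dir⟩
                * star ((Averaging.iter (fun i => blockAvg (P := P) (j := i) (expMeanLogSU (n := n))) j U₀ ⟨b.src, ν⟩ : Matrix.specialUnitaryGroup n ℂ) : Matrix n n ℂ)
              - S j b‖ ^ 2)
          ≤ Real.sqrt ((P.L : ℝ) ^ 2 * (P.L : ℝ) ^ 2 * ((P.L : ℝ) ^ P.d)⁻¹) ^ j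
              * Real.sqrt (∑ b : PBond P 0, ∑ ν : Fin P.d,
                  ‖((U₀ ⟨b.src, ν⟩ : Matrix.specialUnitaryGroup n ℂ) : Matrix n n ℂ) * Y ⟨b.src.shift ν, b.dir⟩
                      * star ((U₀ ⟨b.src, ν⟩ : Matrix.specialUnitaryGroup n ℂ) : Matrix n n ℂ) - Y b‖ ^ 2)
            + (∑ i ∈ range j, Real.sqrt ((P.L : ℝ) ^ 2 * (P.L : ℝ) ^ 2 * ((P.L : ℝ) ^ P.d)⁻¹) ^ (j - 1 - i)
                * ((2 * (P.L : ℝ) ^ 2 * (2 * ε * ((P.L : ℝ) ^ i * ((P.L : ℝ) ^ k)⁻¹) ^ 2) * Real.sqrt ((P.L : ℝ) ^ 2 * (P.L : ℝ) ^ 2 * ((P.L : ℝ) ^ P.d)⁻¹ * P.d)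
                    + (2 * ((P.d : ℝ) + 2) ^ 2 * (P.L : ℝ) ^ 2 * (2 * ε * ((P.L : ℝ) ^ i * ((P.L : ℝ) ^ k)⁻¹) ^ 2)
                        + 4 * ((((P.d + 2) * P.L : ℕ) : ℝ) ^ 2 / 4 * (2 * ε * ((P.L : ℝ) ^ i * ((P.L : ℝ) ^ k)⁻¹) ^ 2)))
                      * Real.sqrt ((P.L : ℝ) * ((P.L : ℝ) ^ P.d)⁻¹ * (P.L : ℝ) * P.d)))
                * Real.sqrt (((P.L : ℝ) ^ P.d)⁻¹ * (P.L : ℝ) ^ 2) ^ i)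
              * Real.sqrt (∑ b : PBond P 0, ‖Y b‖ ^ 2) := by
  have hLpos : (0 : ℝ) < (P.L : ℝ) := by exact_mod_cast P.L_pos
  have hLd : (0 : ℝ) < (P.L : ℝ) ^ P.d := pow_pos hLpos _
  have hLk : (0 : ℝ) < (P.L : ℝ) ^ k := pow_pos hLpos _
  -- abbreviations (real numbers only)
  set ρm : ℝ := Real.sqrt (((P.L : ℝ) ^ P.d)⁻¹ * (P.L : ℝ) ^ 2) with hρm
  set ρg : ℝ := Real.sqrt ((P.L : ℝ) ^ 2 * (P.L : ℝ) ^ 2 * ((P.L : ℝ) ^ P.d)⁻¹) with hρg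
  set M : ℝ := Real.sqrt (∑ b : PBond P 0, ‖Y b‖ ^ 2) with hMdef
  set a : ℕ → ℝ := fun i => 2 * ε * ((P.L : ℝ) ^ i * ((P.L : ℝ) ^ k)⁻¹) ^ 2 with hadef
  set κ : ℕ → ℝ := fun i => 2 * (P.L : ℝ) ^ 2 * a i * Real.sqrt ((P.L : ℝ) ^ 2 * (P.L : ℝ) ^ 2 * ((P.L : ℝ) ^ P.d)⁻¹ * P.d)
      + (2 * ((P.d : ℝ) + 2) ^ 2 * (P.L : ℝ) ^ 2 * a i + 4 * ((((P.d + 2) * P.L : ℕ) : ℝ) ^ 2 / 4 * a i))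
        * Real.sqrt ((P.L : ℝ) * ((P.L : ℝ) ^ P.d)⁻¹ * (P.L : ℝ) * P.d) with hκdef
  set m : ℕ → ℝ := fun j => Real.sqrt (∑ b : PBond P j, ‖S j b‖ ^ 2) with hmdef
  set g : ℕ → ℝ := fun j => Real.sqrt (∑ b : PBond P j, ∑ ν : Fin P.d,
      ‖((Averaging.iter (fun i => blockAvg (P := P) (j := i) (expMeanLogSU (n := n))) j U₀ ⟨b.src, ν⟩ : Matrix.specialUnitaryGroup n ℂ) : Matrix n n ℂ)
          * S j ⟨b.src.shift ν, b.dir⟩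
          * star ((Averaging.iter (fun i => blockAvg (P := P) (j := i) (expMeanLogSU (n := n))) j U₀ ⟨b.src, ν⟩ : Matrix.specialUnitaryGroup n ℂ) : Matrix n n ℂ)
        - S j b‖ ^ 2) with hgdef
  have hρm0 : 0 ≤ ρm := Real.sqrt_nonneg _
  have hρg0 : 0 ≤ ρg := Real.sqrt_nonneg _
  have hM0 : 0 ≤ M := Real.sqrt_nonneg _
  have ha0 : ∀ i, 0 ≤ a i := fun i => by rw [hadef]; positivity
  have hκ0 : ∀ i, 0 ≤ κ i := fun i => by rw [hκdef]; simp only []; have := ha0 i; positivity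
  -- per-level regularity of the tower
  have hplaq : ∀ j, j < k → PlaqSmall (a j) (Averaging.iter (fun i => blockAvg (P := P) (j := i) (expMeanLogSU (n := n))) j U₀) :=
    fun j hj q => (tower_plaq_lt k hε hε3 hε2 hU hj.le q).1
  have hθ : ∀ j, j < k → ∀ (c : PBond P (j + 1)) (i : Idx P),
      dist1 (loopHol (Averaging.iter (fun i => blockAvg (P := P) (j := i) (expMeanLogSU (n := n))) j U₀) c i) ≤ (((P.d + 2) * P.L : ℕ) : ℝ) ^ 2 / 4 * a j :=
    fun j hj c i => dist1_loopHol_le (ha0 j) (hplaq j hj) c i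
  have haj2 : ∀ j, j ≤ k → a j ≤ 2 * ε := fun j hj => by
    rw [hadef]; simp only []
    have hx1 : (P.L : ℝ) ^ j * ((P.L : ℝ) ^ k)⁻¹ ≤ 1 := by
      rw [mul_inv_le_iff₀ hLk, one_mul]; exact pow_le_pow_right₀ (by exact_mod_cast P.L_pos) hj
    have hx0 : 0 ≤ (P.L : ℝ) ^ j * ((P.L : ℝ) ^ k)⁻¹ := by positivity
    nlinarith [mul_le_mul hx1 hx1 hx0 zero_le_one]
  have hθN : ∀ j, j < k → (((P.d + 2) * P.L : ℕ) : ℝ) ^ 2 / 4 * a j < deltaSU n := fun j hj =>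
    lt_of_le_of_lt (mul_le_mul_of_nonneg_left (haj2 j hj.le) (by positivity)) (theta_lt_deltaSU (P := P) (n := n) hε hε2)
  have hθ6 : ∀ j, j < k → (((P.d + 2) * P.L : ℕ) : ℝ) ^ 2 / 4 * a j ≤ 1 / 6 := fun j hj =>
    (mul_le_mul_of_nonneg_left (haj2 j hj.le) (by positivity)).trans (theta_le_sixth (P := P) (n := n) hε hε2)
  -- the two one-step inequalities
  have hstep_m : ∀ j, j < k → m (j + 1) ≤ ρm * m j := by
    intro j hj
    have hj1 : j + 1 ≤ P.m + P.K := by omega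
    have h := sum_normSq_line_le hj1 (Averaging.iter (fun i => blockAvg (P := P) (j := i) (expMeanLogSU (n := n))) j U₀) (S j)
    have hfun : (fun c : PBond P (j + 1) => ‖S (j + 1) c‖ ^ 2) = fun c => ‖((Fintype.card (Idx P) : ℂ))⁻¹ • ∑ i : Idx P,
        ((holAt (Averaging.iter (fun i => blockAvg (P := P) (j := i) (expMeanLogSU (n := n))) j U₀) (walk (emb c.src) (stairWord i.2.1 (off i.1))) :
            Matrix.specialUnitaryGroup n ℂ) : Matrix n n ℂ) *
          covWalkSum (Averaging.iter (fun i => blockAvg (P := P) (j := i) (expMeanLogSU (n := n))) j U₀) (S j)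
            (walk (walkEnd (emb c.src) (stairWord i.2.1 (off i.1))) (List.replicate P.L (c.dir, true))) *
        star ((holAt (Averaging.iter (fun i => blockAvg (P := P) (j := i) (expMeanLogSU (n := n))) j U₀) (walk (emb c.src) (stairWord i.2.1 (off i.1))) :
            Matrix.specialUnitaryGroup n ℂ) : Matrix n n ℂ)‖ ^ 2 := funext fun c => by rw [hSs]
    rw [hmdef]; simp only []
    rw [show (∑ b : PBond P (j + 1), ‖S (j + 1) b‖ ^ 2) = ∑ c : PBond P (j + 1), (fun c => ‖S (j + 1) c‖ ^ 2) c from rfl, hfun, hρm,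
      ← Real.sqrt_mul (by positivity)]
    exact Real.sqrt_le_sqrt h
  have hstep_g : ∀ j, j < k → g (j + 1) ≤ ρg * g j + κ j * m j := by
    intro j hj
    have hj1 : j + 1 ≤ P.m + P.K := by omega
    have h := sqrt_sum_normSq_covGrad_line_le hj1 (Averaging.iter (fun i => blockAvg (P := P) (j := i) (expMeanLogSU (n := n))) j U₀) (ha0 j) (hplaq j hj)
      (S j) (hθ j hj) (hθN j hj) (hθ6 j hj)
    -- rewrite `g (j+1)` into the left-hand side of `h`
    have hfun : (fun b : PBond P (j + 1) => ∑ ν : Fin P.d,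
        ‖((Averaging.iter (fun i => blockAvg (P := P) (j := i) (expMeanLogSU (n := n))) (j + 1) U₀ ⟨b.src, ν⟩ : Matrix.specialUnitaryGroup n ℂ) : Matrix n n ℂ)
            * S (j + 1) ⟨b.src.shift ν, b.dir⟩
            * star ((Averaging.iter (fun i => blockAvg (P := P) (j := i) (expMeanLogSU (n := n))) (j + 1) U₀ ⟨b.src, ν⟩ : Matrix.specialUnitaryGroup n ℂ) :
                Matrix n n ℂ) - S (j + 1) b‖ ^ 2)
        = fun c : PBond P (j + 1) => ∑ ν : Fin P.d,
        ‖((avgFun (expMeanLogSU (n := n)) (Averaging.iter (fun i => blockAvg (P := P) (j := i) (expMeanLogSU (n := n))) j U₀) ⟨c.src, ν⟩ :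
              Matrix.specialUnitaryGroup n ℂ) : Matrix n n ℂ)
            * (((Fintype.card (Idx P) : ℂ))⁻¹ • ∑ i : Idx P,
                ((holAt (Averaging.iter (fun i => blockAvg (P := P) (j := i) (expMeanLogSU (n := n))) j U₀)
                    (walk (emb (c.src.shift ν)) (stairWord i.2.1 (off i.1))) : Matrix.specialUnitaryGroup n ℂ) : Matrix n n ℂ) *
                  covWalkSum (Averaging.iter (fun i => blockAvg (P := P) (j := i) (expMeanLogSU (n := n))) j U₀) (S j)
                    (walk (walkEnd (emb (c.src.shift ν)) (stairWord i.2.1 (off i.1))) (List.replicate P.L (c.dir, true))) *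
                star ((holAt (Averaging.iter (fun i => blockAvg (P := P) (j := i) (expMeanLogSU (n := n))) j U₀)
                    (walk (emb (c.src.shift ν)) (stairWord i.2.1 (off i.1))) : Matrix.specialUnitaryGroup n ℂ) : Matrix n n ℂ))
            * star ((avgFun (expMeanLogSU (n := n)) (Averaging.iter (fun i => blockAvg (P := P) (j := i) (expMeanLogSU (n := n))) j U₀) ⟨c.src, ν⟩ :
              Matrix.specialUnitaryGroup n ℂ) : Matrix n n ℂ)
          - ((Fintype.card (Idx P) : ℂ))⁻¹ • ∑ i : Idx P,
              ((holAt (Averaging.iter (fun i => blockAvg (P := P) (j := i) (expMeanLogSU (n := n))) j U₀) (walk (emb c.src) (stairWord i.2.1 (off i.1))) :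
                  Matrix.specialUnitaryGroup n ℂ) : Matrix n n ℂ) *
                covWalkSum (Averaging.iter (fun i => blockAvg (P := P) (j := i) (expMeanLogSU (n := n))) j U₀) (S j)
                  (walk (walkEnd (emb c.src) (stairWord i.2.1 (off i.1))) (List.replicate P.L (c.dir, true))) *
              star ((holAt (Averaging.iter (fun i => blockAvg (P := P) (j := i) (expMeanLogSU (n := n))) j U₀) (walk (emb c.src) (stairWord i.2.1 (off i.1))) :
                  Matrix.specialUnitaryGroup n ℂ) : Matrix n n ℂ)‖ ^ 2 := by
      funext c
      refine Finset.sum_congr rfl fun ν _ => ?_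
      rw [hSs j ⟨c.src.shift ν, c.dir⟩, hSs j c, iter_succ_apply]
    rw [hgdef, hmdef]; simp only []
    rw [show (∑ b : PBond P (j + 1), ∑ ν : Fin P.d,
        ‖((Averaging.iter (fun i => blockAvg (P := P) (j := i) (expMeanLogSU (n := n))) (j + 1) U₀ ⟨b.src, ν⟩ : Matrix.specialUnitaryGroup n ℂ) : Matrix n n ℂ)
            * S (j + 1) ⟨b.src.shift ν, b.dir⟩
            * star ((Averaging.iter (fun i => blockAvg (P := P) (j := i) (expMeanLogSU (n := n))) (j + 1) U₀ ⟨b.src, ν⟩ : Matrix.specialUnitaryGroup n ℂ) :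
                Matrix n n ℂ) - S (j + 1) b‖ ^ 2)
        = ∑ c : PBond P (j + 1), (fun b : PBond P (j + 1) => ∑ ν : Fin P.d,
        ‖((Averaging.iter (fun i => blockAvg (P := P) (j := i) (expMeanLogSU (n := n))) (j + 1) U₀ ⟨b.src, ν⟩ : Matrix.specialUnitaryGroup n ℂ) : Matrix n n ℂ)
            * S (j + 1) ⟨b.src.shift ν, b.dir⟩
            * star ((Averaging.iter (fun i => blockAvg (P := P) (j := i) (expMeanLogSU (n := n))) (j + 1) U₀ ⟨b.src, ν⟩ : Matrix.specialUnitaryGroup n ℂ) :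
                Matrix n n ℂ) - S (j + 1) b‖ ^ 2) c from rfl, hfun, hρg, hκdef]
    exact h
  -- the recursions
  have hm : ∀ j, j ≤ k → m j ≤ ρm ^ j * M := by
    intro j
    induction j with
    | zero =>
      intro _
      rw [hmdef, hMdef, pow_zero, one_mul]; simp only []
      exact le_of_eq (congrArg Real.sqrt (Finset.sum_congr rfl fun b _ => by rw [hS0]))
    | succ j ih =>
      intro hj
      have hj' : j < k := Nat.lt_of_succ_le hj
      calc m (j + 1) ≤ ρm * m j := hstep_m j hj'
        _ ≤ ρm * (ρm ^ j * M) := mul_le_mul_of_nonneg_left (ih hj'.le) hρm0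
        _ = ρm ^ (j + 1) * M := by rw [pow_succ]; ring
  have hg := grad_recursion hρg0 g m κ hκ0 k hm hstep_g
  intro j hj
  refine ⟨hm j hj, ?_⟩
  have h := hg j hj
  -- `g 0` is the covariant gradient energy of `Y` at `U₀`
  have hg0 : g 0 = Real.sqrt (∑ b : PBond P 0, ∑ ν : Fin P.d,
      ‖((U₀ ⟨b.src, ν⟩ : Matrix.specialUnitaryGroup n ℂ) : Matrix n n ℂ) * Y ⟨b.src.shift ν, b.dir⟩
          * star ((U₀ ⟨b.src, ν⟩ : Matrix.specialUnitaryGroup n ℂ) : Matrix n n ℂ) - Y b‖ ^ 2) := by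
    rw [hgdef]; simp only []
    exact congrArg Real.sqrt (Finset.sum_congr rfl fun b _ => Finset.sum_congr rfl fun ν _ => by rw [hS0, hS0]; rfl)
  rw [hg0] at h
  exact h

end Summit.QuantumFields.YangMills.Theorems.Prop7CovLineIterGrad

end
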